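import Summits.CriticalPhenomena.PercolationContinuityZ3.Theorems.PercNearOneGluingNoHeavyLowerTailGeometricMomentCIL
import Literature.Probability.Percolation.KozmaNitzanClusterPropertyReal
import HarnessLib

/-!
# `NoHeavyLowerTail` (stmt-CriticalPhenomena-4575) — the geometric-moment CIL is Kozma–Nitzan's CONJECTURE 4 for
# ONE explicit one-parameter cluster property, and it HOLDS on Kozma–Nitzan's two proved classes

Support file (lead gen 4; `--supports stmt-CriticalPhenomena-4575`).  No definitions, no named facts, no sorries.

Notation: `μ = prodBernoulli w` on `Fin n`, relays `A`, observer `o`, `π(x) = {a ∈ A : x ↔ a}`, `N = |π(o)|`,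
`U = {o ↔ A} = {N ≥ 1}`, and for `v ∈ [0,1]`:  `L(v) = Σ_{j≥1} v^j P(N = j)`, `R_a(v) = Σ_{j≥0} v^j P(|π(a)| = j)`
(`Theorems.noHeavyLowerTail_of_geometricMomentCIL`: `[∀ graphs ∀ v ∃ a, L(v) ≤ C · R_a(v)] ⇒ crux`).

The real-valued function of vertex sets  `F_v(S) := −v^{|S ∩ A|}`  is monotone (`GeomMomentCIL.geomWeight_mono`),
so `f_v(x, ω) = F_v(C_ω(x))` is a MONOTONE CLUSTER PROPERTY in the sense of Kozma–Nitzan §5.1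
(arXiv:2401.12397 p. 31), and their **Conjecture 4** (p. 32) for this single property reads
`∃ a ∈ A, ∫_U F_v(C(a)) ≤ ∫_U F_v(C(o))`, i.e. `E[v^N ; N ≥ 1] ≤ E[v^{|π(a)|} ; o ↔ A] (≤ R_a(v))` — the
(pre-FKG form of the) geometric-moment CIL with constant `1`.

* `GeomMomentCIL.setIntegral_pow_relayCount_eq_sum` — `∫_D v^{|π(x)|} dμ = Σ_j v^j μ(D ∩ {|π(x)| = j})`.
* `GeomMomentCIL.geometricMomentCIL_of_conjecture4` — a Conjecture-4 inequality for `F_v` at `(o, A, a)` gives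
  `L(v) ≤ R_a(v)` in the level-sum form of the typed hypothesis `hGM` (constant `C = 1`).
* `geometricMomentCIL_of_isolatedObserver` — **GM-CIL(1) for ONE-LAYER observers, every `|A|`, every `v`**:
  `o` joined only to relays ⇒ `∃ a ∈ A, L(v) ≤ R_a(v)` (Kozma–Nitzan Theorem 8 for real cluster properties,
  tree `Literature.Probability.Percolation.KozmaNitzan2024_thm8_real`, with `F = F_v`).
* `geometricMomentCIL_of_card_two` — **GM-CIL(1) for `|A| = 2`, every graph, every `v`** (Theorem 7,
  `KozmaNitzan2024_thm7_real`).
* `noHeavyLowerTail_of_conjecture4_geom` — **the crux follows from Kozma–Nitzan's Conjecture 4 restricted to the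
  one-parameter family `F_v`, `v ∈ (0,1]`** (an explicit WEAKENING of Conjecture 4: one real cluster property
  per `v` instead of all of them; equivalently their pre-FKG conjecture (3) on the graphs with a uniform virtual
  star sink on `A`).
-/

noncomputable section

namespace Summit.CriticalPhenomena.PercolationContinuityZ3.Theorems

open MeasureTheory Set Literature.Probability.LatticeModels Literature.Probability.Percolation
open Summit.CriticalPhenomena.PercolationContinuityZ3.Theses.PercNearOneGluing
open scoped Classical BigOperators

namespace GeomMomentCIL

variable {n : ℕ}

/-- The geometric relay weight `S ↦ −v^{|S ∩ A|}` is monotone for `0 ≤ v ≤ 1`. -/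
theorem geomWeight_mono (A : Finset (Fin n)) (v : ℝ) (hv0 : 0 ≤ v) (hv1 : v ≤ 1) :
    ∀ S T : Set (Fin n), S ⊆ T →
      (fun S : Set (Fin n) => -(v ^ (A.filter fun z => z ∈ S).card)) S ≤
        (fun S : Set (Fin n) => -(v ^ (A.filter fun z => z ∈ S).card)) T := by
  intro S T hST
  have hsub : (A.filter fun z => z ∈ S) ⊆ A.filter fun z => z ∈ T := by
    intro z hz
    rw [Finset.mem_filter] at hz ⊢
    exact ⟨hz.1, hST hz.2⟩
  show -(v ^ (A.filter fun z => z ∈ S).card) ≤ -(v ^ (A.filter fun z => z ∈ T).card)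
  exact neg_le_neg (pow_le_pow_of_le_one hv0 hv1 (Finset.card_le_card hsub))

/-- `∫_D v^{M} dμ = Σ_{j ≤ k} v^j μ(D ∩ {M = j})` for an `ℕ`-valued statistic `M ≤ k`. -/
theorem setIntegral_pow_eq_sum (μ : Measure (BondConfig (Fin n))) [IsFiniteMeasure μ]
    (M : BondConfig (Fin n) → ℕ) (k : ℕ) (hM : ∀ ω, M ω ≤ k) (v : ℝ) (D : Set (BondConfig (Fin n))) :
    ∫ ω in D, v ^ (M ω) ∂μ = ∑ j ∈ Finset.range (k + 1), v ^ j * μ.real (D ∩ {ω | M ω = j}) := by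
  have hrepr : ∀ ω : BondConfig (Fin n), v ^ (M ω) =
      ∑ j ∈ Finset.range (k + 1), ({ω' : BondConfig (Fin n) | M ω' = j}).indicator (fun _ => v ^ j) ω := by
    intro ω
    rw [Finset.sum_eq_single (M ω)]
    · rw [indicator_of_mem (by simp : ω ∈ {ω' : BondConfig (Fin n) | M ω' = M ω})]
    · intro j _ hj
      rw [indicator_of_notMem]
      simpa [Set.mem_setOf_eq] using fun h => hj h.symm
    · intro h
      exact absurd (Finset.mem_range.2 (Nat.lt_succ_of_le (hM ω))) h
  simp_rw [hrepr]
  rw [integral_finsetSum _ fun j _ => ?_]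
  · refine Finset.sum_congr rfl fun j _ => ?_
    rw [setIntegral_indicator (MeasurableSet.of_discrete), setIntegral_const, smul_eq_mul, mul_comm,
      measureReal_def]
  · exact ((integrable_const (v ^ j)).indicator MeasurableSet.of_discrete)

/-- `∫_D v^{|π(x)|} dμ = Σ_{j ≤ |A|} v^j μ(D ∩ {|π(x)| = j})`. -/
theorem setIntegral_pow_relayCount_eq_sum (μ : Measure (BondConfig (Fin n))) [IsFiniteMeasure μ]
    (A : Finset (Fin n)) (x : Fin n) (v : ℝ) (D : Set (BondConfig (Fin n))) :
    ∫ ω in D, v ^ (A.filter fun z => ω ∈ openConn x z).card ∂μ =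
      ∑ j ∈ Finset.range (A.card + 1), v ^ j *
        μ.real (D ∩ {ω | (A.filter fun z => ω ∈ openConn x z).card = j}) :=
  setIntegral_pow_eq_sum μ (fun ω => (A.filter fun z => ω ∈ openConn x z).card) A.card
    (fun _ => Finset.card_le_card (Finset.filter_subset _ _)) v D

/-- `ω ∈ {o ↔ A}` iff `N(ω) ≥ 1`. -/
theorem mem_biUnion_openConn_iff_one_le (A : Finset (Fin n)) (o : Fin n) (ω : BondConfig (Fin n)) :
    ω ∈ (⋃ a ∈ A, (openConn o a : Set (BondConfig (Fin n)))) ↔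
      1 ≤ (A.filter fun z => ω ∈ openConn o z).card := by
  rw [Nat.one_le_iff_ne_zero, Ne, Finset.card_eq_zero, ← Ne, ← Finset.nonempty_iff_ne_empty,
    Finset.filter_nonempty_iff, Set.mem_iUnion₂]
  simp only [exists_prop]

/-- **Conjecture 4 for `F_v` at `(o, A, a)` gives the geometric-moment CIL inequality for the witness `a`**
(level-sum form of the typed hypothesis, constant `1`):  from `∫_U −v^{|π(a)|} ≤ ∫_U −v^{N}`, `U = {o ↔ A}`,
`Σ_{j≥1} v^j μ{N=j} = ∫_U v^N ≤ ∫_U v^{|π(a)|} ≤ ∫ v^{|π(a)|} = Σ_{j≥0} v^j μ{|π(a)| = j}`. -/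
theorem geometricMomentCIL_of_conjecture4 (w : Sym2 (Fin n) → unitInterval) (A : Finset (Fin n))
    (o a : Fin n) (v : ℝ) (hv0 : 0 ≤ v)
    (h4 : ∫ ω in ⋃ a' ∈ A, openConn o a', -(v ^ (A.filter fun z => ω ∈ openConn a z).card)
        ∂(prodBernoulli w) ≤
      ∫ ω in ⋃ a' ∈ A, openConn o a', -(v ^ (A.filter fun z => ω ∈ openConn o z).card)
        ∂(prodBernoulli w)) :
    ∑ j ∈ Finset.Icc 1 A.card, v ^ j * (prodBernoulli w).real {ω : BondConfig (Fin n) |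
        (A.filter fun x => ω ∈ openConn o x).card = j} ≤
      ∑ j ∈ Finset.range (A.card + 1), v ^ j * (prodBernoulli w).real {ω : BondConfig (Fin n) |
        (A.filter fun x => ω ∈ openConn a x).card = j} := by
  set μ := prodBernoulli w with hμ
  set U : Set (BondConfig (Fin n)) := ⋃ a' ∈ A, (openConn o a' : Set (BondConfig (Fin n))) with hU
  -- undo the signs
  rw [integral_neg, integral_neg, neg_le_neg_iff] at h4
  -- left side: `∫_U v^N = Σ_{j ≥ 1} v^j μ{N = j}`
  have hL : ∫ ω in U, v ^ (A.filter fun z => ω ∈ openConn o z).card ∂μ =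
      ∑ j ∈ Finset.Icc 1 A.card, v ^ j * μ.real {ω : BondConfig (Fin n) |
        (A.filter fun x => ω ∈ openConn o x).card = j} := by
    rw [setIntegral_pow_relayCount_eq_sum μ A o v U]
    -- the `j = 0` term vanishes and `U ∩ {N = j} = {N = j}` for `j ≥ 1`
    have hsplit : Finset.range (A.card + 1) = insert 0 (Finset.Icc 1 A.card) := by
      ext j; simp only [Finset.mem_range, Finset.mem_insert, Finset.mem_Icc]; omega
    rw [hsplit, Finset.sum_insert (by simp)]
    have h0 : U ∩ {ω : BondConfig (Fin n) | (A.filter fun z => ω ∈ openConn o z).card = 0} = ∅ := by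
      ext ω
      simp only [mem_inter_iff, mem_setOf_eq, mem_empty_iff_false, iff_false, not_and]
      intro hωU h0
      have := (mem_biUnion_openConn_iff_one_le A o ω).1 hωU
      omega
    rw [h0, measureReal_empty, mul_zero, zero_add]
    refine Finset.sum_congr rfl fun j hj => ?_
    have hj1 : 1 ≤ j := (Finset.mem_Icc.1 hj).1
    congr 2
    ext ω
    simp only [mem_inter_iff, mem_setOf_eq, and_iff_right_iff_imp]
    intro hω
    exact (mem_biUnion_openConn_iff_one_le A o ω).2 (hω ▸ hj1)
  -- right side: `∫_U v^{|π(a)|} ≤ ∫ v^{|π(a)|} = Σ_j v^j μ{|π(a)| = j}`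
  have hR : ∫ ω in U, v ^ (A.filter fun z => ω ∈ openConn a z).card ∂μ ≤
      ∑ j ∈ Finset.range (A.card + 1), v ^ j * μ.real {ω : BondConfig (Fin n) |
        (A.filter fun x => ω ∈ openConn a x).card = j} := by
    have hfull := setIntegral_pow_relayCount_eq_sum μ A a v (univ : Set (BondConfig (Fin n)))
    simp only [univ_inter, Measure.restrict_univ] at hfull
    rw [← hfull]
    exact setIntegral_le_integral (Integrable.of_finite) (ae_of_all _ fun ω => pow_nonneg hv0 _)
  calc ∑ j ∈ Finset.Icc 1 A.card, v ^ j * μ.real {ω : BondConfig (Fin n) |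
          (A.filter fun x => ω ∈ openConn o x).card = j}
      = ∫ ω in U, v ^ (A.filter fun z => ω ∈ openConn o z).card ∂μ := hL.symm
    _ ≤ ∫ ω in U, v ^ (A.filter fun z => ω ∈ openConn a z).card ∂μ := h4
    _ ≤ _ := hR

end GeomMomentCIL

open GeomMomentCIL in
/-- **GM-CIL(1) for ONE-LAYER observers (every `|A|`, every `v ∈ [0,1]`).**  If `o` is joined only to relays
(`w s(o,u) = 0` for `u ∉ A`, `u ≠ o`) and `A ≠ ∅`, then some relay `a ∈ A` has
`Σ_{j≥1} v^j P(N = j) ≤ Σ_{j≥0} v^j P(|π(a)| = j)`: Kozma–Nitzan's Theorem 8 for the real monotone cluster property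
`F_v(S) = −v^{|S ∩ A|}` (`KozmaNitzan2024_thm8_real`).  So the typed target of
`Theorems.noHeavyLowerTail_of_geometricMomentCIL` holds with constant `1` on Kozma–Nitzan's class of Theorem 4/8.
[cite: KozmaNitzan2024, Thm. 8 (p. 32)] -/
theorem geometricMomentCIL_of_isolatedObserver {n : ℕ} (w : Sym2 (Fin n) → unitInterval)
    (A : Finset (Fin n)) (o : Fin n) (v : ℝ) (hv0 : 0 ≤ v) (hv1 : v ≤ 1) (hA : A.Nonempty)
    (hiso : ∀ u, u ≠ o → u ∉ A → w s(o, u) = 0) :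
    ∃ a ∈ A, ∑ j ∈ Finset.Icc 1 A.card, v ^ j * (prodBernoulli w).real {ω : BondConfig (Fin n) |
        (A.filter fun x => ω ∈ openConn o x).card = j} ≤
      ∑ j ∈ Finset.range (A.card + 1), v ^ j * (prodBernoulli w).real {ω : BondConfig (Fin n) |
        (A.filter fun x => ω ∈ openConn a x).card = j} := by
  obtain ⟨a, ha, h⟩ := KozmaNitzan2024_thm8_real w A o
    (fun S : Set (Fin n) => -(v ^ (A.filter fun z => z ∈ S).card)) (geomWeight_mono A v hv0 hv1) hA hiso
  refine ⟨a, ha, geometricMomentCIL_of_conjecture4 w A o a v hv0 ?_⟩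
  simpa only [KNPreFKG.relayCount_openCluster] using h

open GeomMomentCIL in
/-- **GM-CIL(1) for `|A| = 2` (every graph, every `v ∈ [0,1]`)**: Kozma–Nitzan's Theorem 7 for the real monotone
cluster property `F_v(S) = −v^{|S ∩ A|}` (`KozmaNitzan2024_thm7_real`). [cite: KozmaNitzan2024, Thm. 7 (p. 32)] -/
theorem geometricMomentCIL_of_card_two {n : ℕ} (w : Sym2 (Fin n) → unitInterval)
    (A : Finset (Fin n)) (o : Fin n) (v : ℝ) (hv0 : 0 ≤ v) (hv1 : v ≤ 1) (hA : A.card = 2) :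
    ∃ a ∈ A, ∑ j ∈ Finset.Icc 1 A.card, v ^ j * (prodBernoulli w).real {ω : BondConfig (Fin n) |
        (A.filter fun x => ω ∈ openConn o x).card = j} ≤
      ∑ j ∈ Finset.range (A.card + 1), v ^ j * (prodBernoulli w).real {ω : BondConfig (Fin n) |
        (A.filter fun x => ω ∈ openConn a x).card = j} := by
  obtain ⟨a, ha, h⟩ := KozmaNitzan2024_thm7_real w A o
    (fun S : Set (Fin n) => -(v ^ (A.filter fun z => z ∈ S).card)) (geomWeight_mono A v hv0 hv1) hA
  refine ⟨a, ha, geometricMomentCIL_of_conjecture4 w A o a v hv0 ?_⟩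
  simpa only [KNPreFKG.relayCount_openCluster] using h

open GeomMomentCIL in
/-- **Kozma–Nitzan's Conjecture 4 for the one-parameter family `F_v(S) = −v^{|S ∩ A|}` ⇒ `NoHeavyLowerTail`.**
If for every finite weighted graph, every nonempty `A`, every `o ∉ A` and every `v ∈ (0,1]` some relay `a ∈ A`
satisfies the Conjecture-4 inequality `∫_{o↔A} F_v(C(a)) ≤ ∫_{o↔A} F_v(C(o))`, then the crux holds
(through `Theorems.noHeavyLowerTail_of_geometricMomentCIL` with `C = 1`).  Conjecture 4 for ALL monotone cluster
properties (arXiv:2401.12397 p. 32) is thus more than needed: this single family suffices.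
[cite: KozmaNitzan2024, Conjecture 4 (p. 32)] -/
theorem noHeavyLowerTail_of_conjecture4_geom
    (h4 : ∀ (n : ℕ) (w : Sym2 (Fin n) → unitInterval) (A : Finset (Fin n)) (o : Fin n) (v : ℝ),
      0 < v → v ≤ 1 → A.Nonempty → o ∉ A → ∃ a ∈ A,
        ∫ ω in ⋃ a' ∈ A, openConn o a', -(v ^ (A.filter fun z => ω ∈ openConn a z).card)
            ∂(prodBernoulli w) ≤
          ∫ ω in ⋃ a' ∈ A, openConn o a', -(v ^ (A.filter fun z => ω ∈ openConn o z).card)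
            ∂(prodBernoulli w)) :
    Summit.CriticalPhenomena.PercolationContinuityZ3.Theses.PercNearOneGluing.NoHeavyLowerTail := by
  refine noHeavyLowerTail_of_geometricMomentCIL 1 zero_le_one fun n w A o v hv0 hv1 hA ho => ?_
  obtain ⟨a, ha, h⟩ := h4 n w A o v hv0 hv1 hA ho
  exact ⟨a, ha, by simpa only [one_mul] using geometricMomentCIL_of_conjecture4 w A o a v hv0.le h⟩
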